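import Summits.CriticalPhenomena.SAWScalingLimit.Theorems.SAWLeftRightFKGLeftRightFKGRectBoundaryWalk
import Summits.CriticalPhenomena.SAWScalingLimit.Theorems.LeftRightFKG.Negative.RectMesh
import Summits.CriticalPhenomena.SAWScalingLimit.Theorems.LeftRightFKG.Negative.OrderCharacterisation
import HarnessLib

/-!
# Crux `LeftRightFKG` (stmt-CriticalPhenomena-11232), line `corner-localisation` (v9):
the boundary walk of a NOTCHED box (`stub_notchedBoxWalkAux`, auxiliary to tool T9b
`stub_notchedBoxWalk`)

For walls `x₀ < x_s < x₁`, `y₀ + 2 < y₁` we construct the closed lattice walk based at the corner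
`(x₀, y₀)` obtained from the counter-clockwise boundary walk of the rectangle `[x₀, x₁] × [y₀, y₁]`
(`Families.stub_rectBoundaryWalk`, tool T1) by splitting it at the bottom-wall vertex `(x_s, y₀)`
(`SimpleGraph.Walk.take_spec`) and splicing in the unit SPUR `(x_s, y₀) → (x_s, y₀ + 1) → (x_s, y₀)`
(`SimpleGraph.Walk` allows the repeated edge), and we record what the realisation of the notched box
`box ∖ {(x_s, y₀ + 1)}` as a crux domain `{z | wind(C, z) ≠ 0}` needs (`stub_notchedBoxWalkAux`):
`(x_s - 1, y₀)` and the spur tip are vertices; all vertices lie in the closed rectangle; every wall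
lattice point is a vertex; consecutive vertices lie on a common wall line or on the spur line
`x = x_s` at heights `≤ y₀ + 1` (this controls the trace); and the winding number about the centre
of EVERY face of the rectangle is `1`.  The last point: the spur's two darts are mutually reverse,
so they contribute `edgeCross + (-edgeCross) = 0` to every signed crossing count
(`Negative.edgeCross_symm`, `Negative.wcross_append`), whence the spliced walk has the crossing
counts of the rectangle walk, which are `-1` at every interior face (`Negative.Rect.wind_C_probe`
and `Negative.Rect.wind_C_of_mem_Rint`); the winding number about a face centre is minus the
crossing count (`Negative.wind_poly_probeL`).  Also recorded here, for the main file: generic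
facts on closed lattice walks — a relation chaining the support holds on darts and conversely,
the winding number is constant along segments missing the trace (`wind_eq_of_segment`), and a
point off the trace has the winding number of its face centre (`wind_eq_wind_probeL`, the
argument of `Negative.wind_nonneg_iff_wcross`).  Everything is elementary. [folklore]
-/

open Set Complex Literature.Probability.LatticeModels Literature.Probability.RandomPlanarGeometry
  Literature.Topology.PlaneTopology
open Summit.CriticalPhenomena.SAWScalingLimit.Theorems.LeftRightFKG.Negative

namespace Summit.CriticalPhenomena.SAWScalingLimit.Theorems.LeftRightFKG.Families

namespace NotchedBox

/-! ## Darts versus chained supports -/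

/-- A relation chaining the vertex list of a walk holds on every dart. [folklore] -/
theorem rel_of_isChain {G : SimpleGraph (Site 2)} {R : Site 2 → Site 2 → Prop} :
    ∀ {u v : Site 2} (w : G.Walk u v), List.IsChain R (u :: w.support.tail) →
      ∀ d ∈ w.darts, R d.fst d.snd
  | _, _, SimpleGraph.Walk.nil, _, d, hd => by simp at hd
  | u, _, SimpleGraph.Walk.cons (v := v') h p, hc, d, hd => by
    rw [SimpleGraph.Walk.support_cons, List.tail_cons, ← p.cons_tail_support,
      List.isChain_cons_cons] at hc
    rw [SimpleGraph.Walk.darts_cons, List.mem_cons] at hd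
    rcases hd with rfl | hd
    · exact hc.1
    · exact rel_of_isChain p hc.2 d hd

-- adapted from `Families.isChain_of_darts` (private, `…RectBoundaryWalk.lean`)
/-- A relation holding on every dart of a walk chains its vertex list. [folklore] -/
theorem isChain_of_darts {G : SimpleGraph (Site 2)} {R : Site 2 → Site 2 → Prop} :
    ∀ {u v : Site 2} (w : G.Walk u v), (∀ d ∈ w.darts, R d.fst d.snd) →
      List.IsChain R (u :: w.support.tail)
  | _, _, SimpleGraph.Walk.nil, _ => List.isChain_singleton _
  | u, _, SimpleGraph.Walk.cons (v := v') h p, hd => by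
    rw [SimpleGraph.Walk.support_cons, List.tail_cons, ← p.cons_tail_support,
      List.isChain_cons_cons]
    rw [SimpleGraph.Walk.darts_cons] at hd
    exact ⟨hd ⟨(u, v'), h⟩ (by simp),
      isChain_of_darts p fun d hd' => hd d (List.mem_cons_of_mem _ hd')⟩

/-! ## Winding numbers of closed lattice walks: local constancy and face centres -/

/-- Along a segment missing the trace of a closed lattice walk the winding number is constant.
[folklore] -/
theorem wind_eq_of_segment {c : Site 2} (C : (zdGraph 2).Walk c c) {a z : ℂ}
    (h : segment ℝ a z ⊆ (range (poly c C.support.tail))ᶜ) :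
    wind (fun t => (poly c C.support.tail).extend t - z) =
      wind (fun t => (poly c C.support.tail).extend t - a) := by
  set P := poly c C.support.tail
  have hK : IsClosed (range P) := (isCompact_range P.continuous).isClosed
  have hcc : z ∈ connectedComponentIn (range P)ᶜ a :=
    (convex_segment _ _).isPreconnected.subset_connectedComponentIn (left_mem_segment _ _ _) h
      (right_mem_segment _ _ _)
  have h01 : P.extend 0 = P.extend 1 := by
    rw [Path.extend_zero, Path.extend_one, poly_fst_walk C]
  exact (wind_sub_eq_of_mem_connectedComponentIn P.continuous_extend.continuousOn h01 hK
    (fun t ht => by rw [Path.extend_apply P ht]; exact ⟨_, rfl⟩) hcc).symm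

/-- Off the trace of a closed lattice walk, a point has the winding number of the centre of its
face (the segment joining them misses the trace, whose points have an integral coordinate).
[folklore] -/
theorem wind_eq_wind_probeL {c : Site 2} (C : (zdGraph 2).Walk c c) {z : ℂ}
    (hz : z ∉ range (poly c C.support.tail)) :
    wind (fun t => (poly c C.support.tail).extend t - z) =
      wind (fun t => (poly c C.support.tail).extend t - probeL ⌊z.re⌋ ⌊z.im⌋) := by
  have hchain := isChain_support (fun _ _ h => h) C
  refine wind_eq_of_segment C ?_
  rw [segment_symm, ← insert_endpoints_openSegment]
  rintro y (rfl | rfl | hy)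
  · exact hz
  · exact probeL_not_mem_range_poly _ _ hchain
  · intro hyP
    have hyF := openSegment_subset_openFace (Int.floor_le z.re) (Int.lt_floor_add_one z.re).le
      (Int.floor_le z.im) (Int.lt_floor_add_one z.im).le hy
    exact not_int_of_mem_openFace hyF (exists_int_of_mem_range_poly c _ hchain _ hyP)

/-- The winding number of a closed lattice walk about a face centre is minus its signed crossing
count over the upward probe (all heights `≤ Y`, `k ≤ Y`). [folklore] -/
theorem wind_probeL_eq_neg_wcross {c : Site 2} (C : (zdGraph 2).Walk c c) {m k Y : ℤ}
    (hkY : k ≤ Y) (hY : ∀ x ∈ C.support, x 1 ≤ Y) :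
    wind (fun t => (poly c C.support.tail).extend t - probeL m k) = -wcross m k C := by
  have h := wind_poly_probeL (m := m) hkY c C.support.tail (isChain_support (fun _ _ h => h) C)
    (hY c C.start_mem_support) (fun x hx => hY x (List.mem_of_mem_tail hx)) (poly_fst_walk C)
  unfold wcross
  exact_mod_cast h

/-! ## Splicing a unit spur into a closed walk -/

section Splice

variable {c v s : Site 2} (A : (zdGraph 2).Walk c v) (B : (zdGraph 2).Walk v c)
  (hvs : (zdGraph 2).Adj v s)

/-- Vertices of the walk `A · (v → s → v) · B`: those of `A · B`, and the spur tip `s`. [folklore] -/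
theorem mem_support_splice (x : Site 2) :
    x ∈ (A.append ((SimpleGraph.Walk.cons hvs (SimpleGraph.Walk.cons hvs.symm
      SimpleGraph.Walk.nil)).append B)).support ↔ x ∈ (A.append B).support ∨ x = s := by
  have hv : x = v → x ∈ B.support := fun h => h ▸ B.start_mem_support
  simp only [SimpleGraph.Walk.mem_support_append_iff, SimpleGraph.Walk.support_cons,
    SimpleGraph.Walk.support_nil, List.mem_cons, List.not_mem_nil, or_false]
  tauto

/-- Darts of the walk `A · (v → s → v) · B`: those of `A · B`, and the two spur darts. [folklore] -/
theorem mem_darts_splice (d : (zdGraph 2).Dart)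
    (hd : d ∈ (A.append ((SimpleGraph.Walk.cons hvs (SimpleGraph.Walk.cons hvs.symm
      SimpleGraph.Walk.nil)).append B)).darts) :
    d ∈ (A.append B).darts ∨ (d.fst = v ∧ d.snd = s) ∨ (d.fst = s ∧ d.snd = v) := by
  simp only [SimpleGraph.Walk.darts_append, SimpleGraph.Walk.darts_cons,
    SimpleGraph.Walk.darts_nil, List.mem_append, List.mem_cons, List.not_mem_nil,
    or_false] at hd ⊢
  rcases hd with hd | (rfl | rfl) | hd
  · exact Or.inl (Or.inl hd)
  · exact Or.inr (Or.inl ⟨rfl, rfl⟩)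
  · exact Or.inr (Or.inr ⟨rfl, rfl⟩)
  · exact Or.inl (Or.inr hd)

/-- The spur contributes nothing to any signed crossing count (its two darts are mutually
reverse). [folklore] -/
theorem wcross_splice (m k : ℤ) :
    wcross m k (A.append ((SimpleGraph.Walk.cons hvs (SimpleGraph.Walk.cons hvs.symm
      SimpleGraph.Walk.nil)).append B)) = wcross m k (A.append B) := by
  have h0 : wcross m k (SimpleGraph.Walk.cons hvs (SimpleGraph.Walk.cons hvs.symm
      (SimpleGraph.Walk.nil : (zdGraph 2).Walk v v))) = 0 := by
    show pathCross m k v [s, v] = 0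
    rw [pathCross_cons, pathCross_cons, pathCross_nil, edgeCross_symm m k v s]
    ring
  rw [wcross_append, wcross_append, wcross_append, h0, zero_add]

end Splice

/-! ## The notched-box walk -/

/-- The notched-box walk from a boundary walk of the rectangle (hypotheses of
`Negative.Rect.meshVertices_Ω` with crossing count `-1` at the corner face) given split at the foot
`(x_s, y₀)` of the spur as `A · B`: the walk `A · spur · B` has `(x_s - 1, y₀)` and the spur tip
among its vertices, vertices in the closed rectangle, every wall lattice point as a vertex,
consecutive vertices on a common wall line or on the spur line at heights `≤ y₀ + 1`, and winding
number `1` about the centre of every face of the rectangle. [folklore] -/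
theorem notched_of_split {x₀ x₁ y₀ y₁ x_s : ℤ} (hs₀ : x₀ < x_s) (hs₁ : x_s < x₁)
    (hy : y₀ + 2 < y₁) (A : (zdGraph 2).Walk (bx x₀ y₀) (bx x_s y₀))
    (B : (zdGraph 2).Walk (bx x_s y₀) (bx x₀ y₀))
    (hb : ∀ x ∈ (A.append B).support, (x₀ ≤ x 0 ∧ x 0 ≤ x₁) ∧ (y₀ ≤ x 1 ∧ x 1 ≤ y₁))
    (hch : List.IsChain (fun p q : Site 2 => (p 1 = y₀ ∧ q 1 = y₀) ∨ (p 0 = x₁ ∧ q 0 = x₁) ∨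
      (p 1 = y₁ ∧ q 1 = y₁) ∨ (p 0 = x₀ ∧ q 0 = x₀)) (bx x₀ y₀ :: (A.append B).support.tail))
    (hcomp : ∀ i j : ℤ, x₀ ≤ i → i ≤ x₁ → y₀ ≤ j → j ≤ y₁ →
      (i = x₀ ∨ i = x₁ ∨ j = y₀ ∨ j = y₁) → bx i j ∈ (A.append B).support)
    (hcross : pathCross x₀ y₀ (bx x₀ y₀) (A.append B).support.tail = -1) :
    ∃ C : (zdGraph 2).Walk (bx x₀ y₀) (bx x₀ y₀),
      bx (x_s - 1) y₀ ∈ C.support ∧ bx x_s (y₀ + 1) ∈ C.support ∧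
      (∀ x ∈ C.support, (x₀ ≤ x 0 ∧ x 0 ≤ x₁) ∧ (y₀ ≤ x 1 ∧ x 1 ≤ y₁)) ∧
      (∀ i j : ℤ, x₀ ≤ i → i ≤ x₁ → y₀ ≤ j → j ≤ y₁ → (i = x₀ ∨ i = x₁ ∨ j = y₀ ∨ j = y₁) →
        bx i j ∈ C.support) ∧
      List.IsChain (fun p q : Site 2 => ((p 1 = y₀ ∧ q 1 = y₀) ∨ (p 0 = x₁ ∧ q 0 = x₁) ∨
        (p 1 = y₁ ∧ q 1 = y₁) ∨ (p 0 = x₀ ∧ q 0 = x₀)) ∨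
        (p 0 = x_s ∧ q 0 = x_s ∧ p 1 ≤ y₀ + 1 ∧ q 1 ≤ y₀ + 1)) (bx x₀ y₀ :: C.support.tail) ∧
      (∀ m k : ℤ, x₀ ≤ m → m < x₁ → y₀ ≤ k → k < y₁ →
        wind (fun t : ℝ => (poly (bx x₀ y₀) C.support.tail).extend t - probeL m k) = 1) := by
  have hvs : (zdGraph 2).Adj (bx x_s y₀) (bx x_s (y₀ + 1)) :=
    adj_bx _ _ _ _ (Or.inr (Or.inr (Or.inl ⟨rfl, rfl⟩)))
  have hb' : ∀ x ∈ (A.append ((SimpleGraph.Walk.cons hvs (SimpleGraph.Walk.cons hvs.symm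
      SimpleGraph.Walk.nil)).append B)).support, (x₀ ≤ x 0 ∧ x 0 ≤ x₁) ∧ (y₀ ≤ x 1 ∧ x 1 ≤ y₁) := by
    intro x hx
    rcases (mem_support_splice A B hvs x).1 hx with hx | rfl
    · exact hb x hx
    · simp only [bx_zero, bx_one]; omega
  refine ⟨A.append ((SimpleGraph.Walk.cons hvs (SimpleGraph.Walk.cons hvs.symm
    SimpleGraph.Walk.nil)).append B), ?_, ?_, hb', ?_, ?_, ?_⟩
  · exact (mem_support_splice A B hvs _).2 (Or.inl (hcomp _ _ (by omega) (by omega) le_rfl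
      (by omega) (Or.inr (Or.inr (Or.inl rfl)))))
  · exact (mem_support_splice A B hvs _).2 (Or.inr rfl)
  · intro i j hi hi' hj hj' hw
    exact (mem_support_splice A B hvs _).2 (Or.inl (hcomp i j hi hi' hj hj' hw))
  · refine isChain_of_darts _ fun d hd => ?_
    rcases mem_darts_splice A B hvs d hd with hd | ⟨h1, h2⟩ | ⟨h1, h2⟩
    · exact Or.inl (rel_of_isChain _ hch d hd)
    · right; rw [h1, h2]; exact ⟨rfl, rfl, by simp only [bx_one]; omega, le_of_eq rfl⟩
    · right; rw [h1, h2]; exact ⟨rfl, rfl, le_of_eq rfl, by simp only [bx_one]; omega⟩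
  · intro m k hm hm' hk hk'
    have hface : x₀ ≤ m ∧ m + 1 ≤ x₁ ∧ y₀ ≤ k ∧ k + 1 ≤ y₁ := ⟨hm, by omega, hk, by omega⟩
    have hface₀ : x₀ ≤ x₀ ∧ x₀ + 1 ≤ x₁ ∧ y₀ ≤ y₀ ∧ y₀ + 1 ≤ y₁ :=
      ⟨le_rfl, by omega, le_rfl, by omega⟩
    have e1 := Rect.wind_C_probe hb hface
    have e2 := Rect.wind_C_of_mem_Rint hb hch hface₀ (by rw [hcross]; norm_num)
      (Rect.probe_mem_Rint hface)
    rw [hcross, e1] at e2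
    have e3 : wcross m k (A.append B) = -1 := by unfold wcross; omega
    rw [wind_probeL_eq_neg_wcross _ hk'.le fun x hx => (hb' x hx).2.2, wcross_splice, e3]
    norm_num

end NotchedBox

/-! ## The registered auxiliary stub -/

/-- **Registered auxiliary stub `stub_notchedBoxWalkAux` (tool T9b, part 1: the walk).** For
walls `x₀ < x_s < x₁`, `y₀ + 2 < y₁` there is a closed lattice walk `C` based at `(x₀, y₀)` — the
counter-clockwise boundary walk of `[x₀, x₁] × [y₀, y₁]` with the unit spur
`(x_s, y₀) → (x_s, y₀ + 1) → (x_s, y₀)` spliced in — such that: `(x_s - 1, y₀)` and the spur tip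
`(x_s, y₀ + 1)` are vertices; all vertices lie in the closed rectangle; every wall lattice point is
a vertex; consecutive vertices lie on a common wall line or on the spur line `x = x_s` at heights
`≤ y₀ + 1`; and the winding number of its polyline about the centre of every face of the rectangle
is `1`. [folklore] -/
theorem stub_notchedBoxWalkAux : ∀ (x₀ x₁ y₀ y₁ x_s : ℤ), x₀ < x_s → x_s < x₁ → y₀ + 2 < y₁ →
    ∃ C : (zdGraph 2).Walk (bx x₀ y₀) (bx x₀ y₀),
      bx (x_s - 1) y₀ ∈ C.support ∧ bx x_s (y₀ + 1) ∈ C.support ∧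
      (∀ x ∈ C.support, (x₀ ≤ x 0 ∧ x 0 ≤ x₁) ∧ (y₀ ≤ x 1 ∧ x 1 ≤ y₁)) ∧
      (∀ i j : ℤ, x₀ ≤ i → i ≤ x₁ → y₀ ≤ j → j ≤ y₁ → (i = x₀ ∨ i = x₁ ∨ j = y₀ ∨ j = y₁) →
        bx i j ∈ C.support) ∧
      List.IsChain (fun p q : Site 2 => ((p 1 = y₀ ∧ q 1 = y₀) ∨ (p 0 = x₁ ∧ q 0 = x₁) ∨
        (p 1 = y₁ ∧ q 1 = y₁) ∨ (p 0 = x₀ ∧ q 0 = x₀)) ∨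
        (p 0 = x_s ∧ q 0 = x_s ∧ p 1 ≤ y₀ + 1 ∧ q 1 ≤ y₀ + 1)) (bx x₀ y₀ :: C.support.tail) ∧
      (∀ m k : ℤ, x₀ ≤ m → m < x₁ → y₀ ≤ k → k < y₁ →
        wind (fun t : ℝ => (Negative.poly (bx x₀ y₀) C.support.tail).extend t -
          Negative.probeL m k) = 1) := by
  intro x₀ x₁ y₀ y₁ x_s hs₀ hs₁ hy
  obtain ⟨C, hb, hch, hcomp, hcross⟩ := stub_rectBoundaryWalk x₀ x₁ y₀ y₁ (by omega) (by omega)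
  have hv : bx x_s y₀ ∈ C.support :=
    hcomp x_s y₀ (by omega) (by omega) le_rfl (by omega) (Or.inr (Or.inr (Or.inl rfl)))
  obtain ⟨A, B, hAB⟩ : ∃ (A : (zdGraph 2).Walk (bx x₀ y₀) (bx x_s y₀))
      (B : (zdGraph 2).Walk (bx x_s y₀) (bx x₀ y₀)), A.append B = C :=
    ⟨C.takeUntil _ hv, C.dropUntil _ hv, C.take_spec hv⟩
  subst hAB
  exact NotchedBox.notched_of_split hs₀ hs₁ hy A B hb hch hcomp hcross

end Summit.CriticalPhenomena.SAWScalingLimit.Theorems.LeftRightFKG.Families
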